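import Literature.Computability.QuantumComplexity.ConeSimFront
import Literature.Computability.QuantumComplexity.LightConeFilter
import HarnessLib

/-!
# The cone simulator, IV: sizes never overflow the yardstick; the decider computes `[p(x) > 1/2]`

Topic `Literature/Computability/QuantumComplexity`, closing the simulator of `ConeSimStep.lean`,
`ConeSimModel.lean`, `ConeSimLoop.lean`, `ConeSimFront.lean` (`deciderF q c Y F ∈ FP`, whose value
on `x` is the core `simCoreF` on `⟨⟨ŷ, table of dpInit over the window labels⟩, codes of the gates
inside the window [0, K₀)⟩`, `K₀ = qc (|bin n| + 1) + 1`). Here: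

* `yardPoly q c` — an explicit polynomial `Y` with `2^k ≤ Y(S)` and
  `2^k (4N + 28B + 46) ≤ Y(S)` (`S = |⟨x, d⟩|`, `B = 2T(k+1) + k + 4`, `T` gates inside the window,
  `k = min K₀ N`), from `2^{|bin n|} ≤ 2n + 1` (`two_pow_kay0_le`);
* the shortness hypotheses of the core (`TblShort`, `SumsShort`, `StatsShort`) for the genuine
  run, from the coefficient growth `(2L)^t` of `ConeSimModel.lean` (`short_of_yard`);
* **`deciderF_correct`**: for an oracle-free family whose wire-`0` light cones lie inside the
  windows `[0, K₀)`, `deciderF q c (yardPoly q c) F x = [decide (1/2 < F.acceptProbOn 0 x)]` on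
  every input `x` — by `simCoreF_genuine`, `tblRun_map` (the machine's table is `dpRun` over the
  window labels), `half_lt_probAcc_iff` (exact sign test) and
  `LightCone.acceptProb_eq_acceptProb_filter_subset` (the windowed circuit has the same
  acceptance probability);
* `polyTimeDecidable_of_cone_subset_window`: hence the threshold language is in
  `PolyTimeDecidable id` for a uniform such family (`mem_P_of_mem_FP`, `mem_P_iff_holds`).

## References

* I. L. Markov, Y. Shi, *Simulating quantum computation by contracting tensor networks*, SIAM J.
  Comput. 38 (2008) 963–981, §1 (Cor. 1.5; deterministic simulation = exact probability).
* M. A. Nielsen, I. L. Chuang, *Quantum Computation and Quantum Information*, CUP 2010, §4.5.5.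
* S. Arora, B. Barak, *Computational Complexity: A Modern Approach*, CUP 2009, §1.3, §6.2.
-/

noncomputable section

namespace Literature.Computability.QuantumComplexity

namespace ConeSim

open _root_.Computability Polynomial Complexity Complexity.Brick Cryptography ZW ZWCode ADH

variable {N : ℕ}

/-! ### Arithmetic of the window bound -/

/-- `log₂ n ≤ |bin n|`. [folklore] -/
theorem log_le_length_encodeNat (n : ℕ) : Nat.log 2 n ≤ (encodeNat n).length := by
  rcases Nat.eq_zero_or_pos n with rfl | hn
  · simp
  · exact (Nat.log_lt_of_lt_pow hn.ne' ((length_encodeNat_le_iff n _).1 le_rfl)).le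

/-- `2^{K₀} ≤ 2 (4n + 2)^{qc}`. [folklore] -/
theorem two_pow_kay0_le (q c n : ℕ) : 2 ^ kay0 q c n ≤ 2 * (4 * n + 2) ^ (q * c) := by
  -- `2^{|bin n|} ≤ 2n + 1` (also `NSETHBridge.two_pow_length_encodeNat_le`, not imported here)
  have h : 2 ^ (encodeNat n).length ≤ 2 * n + 1 := by
    rcases Nat.eq_zero_or_pos (encodeNat n).length with h | h
    · rw [h]; simp
    · have h1 : ¬ ((encodeNat n).length ≤ (encodeNat n).length - 1) := by omega
      rw [length_encodeNat_le_iff] at h1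
      push Not at h1
      have : 2 ^ (encodeNat n).length = 2 * 2 ^ ((encodeNat n).length - 1) := by
        rw [← pow_succ']; congr 1; omega
      omega
  have e : 2 ^ kay0 q c n = 2 * (2 ^ ((encodeNat n).length + 1)) ^ (q * c) := by
    unfold kay0
    rw [pow_succ, mul_comm (q * c), pow_mul, mul_comm]
  rw [e]
  refine Nat.mul_le_mul_left 2 (Nat.pow_le_pow_left ?_ _)
  rw [pow_succ]
  omega

/-- **The yardstick polynomial** `Y(S) = 2 (4S+2)^{qc} · (4S + 28 (2S(κ+1) + κ + 4) + 46)`,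
`κ = qc (S+1) + 1`. [folklore] -/
def yardPoly (q c : ℕ) : Polynomial ℕ :=
  C 2 * (C 4 * X + C 2) ^ (q * c) *
    (C 4 * X + C 28 * (C 2 * (X * (C (q * c) * (X + 1) + 1 + 1)) + (C (q * c) * (X + 1) + 1) + C 4) + C 46)

/-- The value of the yardstick polynomial. [folklore] -/
theorem yardPoly_eval (q c S : ℕ) :
    (yardPoly q c).eval S = 2 * (4 * S + 2) ^ (q * c) *
      (4 * S + 28 * (2 * (S * (q * c * (S + 1) + 1 + 1)) + (q * c * (S + 1) + 1) + 4) + 46) := by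
  simp [yardPoly]

section Sizes

variable (q c : ℕ) (F : QCircuitFamily cliffordT) (x : List Bool)

/-- The size of the pair `⟨x, d⟩` clocking the yardstick. [folklore] -/
def bigS : ℕ := (boolPair x (F.descFn x)).length

/-- `S = 2n + 2 + |d|`. [folklore] -/
theorem bigS_eq : bigS F x = 2 * x.length + 2 + (F.descFn x).length := by
  unfold bigS; rw [length_boolPair]

/-- `n ≤ S`, `|d| ≤ S`. [folklore] -/
theorem le_bigS : x.length ≤ bigS F x ∧ (F.descFn x).length ≤ bigS F x := by
  rw [bigS_eq]; omega

/-- The register size is at most `S`. [folklore] -/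
theorem reg_le_bigS : x.length + F.ancillas x.length ≤ bigS F x := by
  have h := bigS_eq F x
  have hd : 2 * F.ancillas x.length ≤ (F.descFn x).length := by
    rw [descFn_eq, length_boolPair, length_boolPair]; simp only [ones, List.length_replicate]; omega
  omega

/-- The number of gates is at most `S`. [folklore] -/
theorem gates_le_bigS : (F.circ x.length).gates.length ≤ bigS F x :=
  (length_gates_le_length_descFn F x).trans (le_bigS F x).2

/-- `K₀ ≤ qc (S + 1) + 1`. [folklore] -/
theorem kay0_le_bigS : kay0 q c x.length ≤ q * c * (bigS F x + 1) + 1 := by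
  have h : (encodeNat x.length).length ≤ bigS F x := by
    have := (le_bigS F x).2
    rw [descFn_eq, length_boolPair] at this
    omega
  unfold kay0
  have := Nat.mul_le_mul_left (q * c) (Nat.add_le_add_right h 1)
  omega

/-- The length of the yardstick. [folklore] -/
theorem length_ydF_yardPoly : (ydF (yardPoly q c) F x).length = (yardPoly q c).eval (bigS F x) := by
  obtain ⟨-, -, -, -, -, -, -, -, hy⟩ := front_values q c (yardPoly q c) F x
  rw [hy]
  simp [ones, bigS]

/-- **The yardstick dominates the number of labels.** [folklore] -/
theorem two_pow_kay_le_yard : 2 ^ kay q c F x ≤ (ydF (yardPoly q c) F x).length := by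
  rw [length_ydF_yardPoly, yardPoly_eval]
  have h1 : 2 ^ kay q c F x ≤ 2 ^ kay0 q c x.length := Nat.pow_le_pow_right (by norm_num) (Nat.min_le_left _ _)
  have h2 := two_pow_kay0_le q c x.length
  have h3 : 2 * (4 * x.length + 2) ^ (q * c) ≤ 2 * (4 * bigS F x + 2) ^ (q * c) :=
    Nat.mul_le_mul_left 2 (Nat.pow_le_pow_left (by have := (le_bigS F x).1; omega) _)
  calc 2 ^ kay q c F x ≤ 2 * (4 * bigS F x + 2) ^ (q * c) := h1.trans (h2.trans h3)
    _ ≤ _ := Nat.le_mul_of_pos_right _ (by omega)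

/-- The size parameter `B = 2T(k+1) + k + 4` of a run of `T` gates on `2^k` labels. [folklore] -/
def bigB (T k : ℕ) : ℕ := 2 * (T * (k + 1)) + k + 4

/-- **The yardstick dominates the tables**: `2^k (4N + 28B + 46) ≤ |ŷ|` for every `T ≤ S`.
[folklore] -/
theorem table_le_yard (T : ℕ) (hT : T ≤ bigS F x) :
    2 ^ kay q c F x * (4 * (x.length + F.ancillas x.length) + 28 * bigB T (kay q c F x) + 46) ≤
      (ydF (yardPoly q c) F x).length := by
  rw [length_ydF_yardPoly, yardPoly_eval]
  have hk : kay q c F x ≤ q * c * (bigS F x + 1) + 1 := (Nat.min_le_left _ _).trans (kay0_le_bigS q c F x)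
  have h1 : 2 ^ kay q c F x ≤ 2 * (4 * bigS F x + 2) ^ (q * c) := by
    have h2 := two_pow_kay0_le q c x.length
    have h3 : 2 * (4 * x.length + 2) ^ (q * c) ≤ 2 * (4 * bigS F x + 2) ^ (q * c) :=
      Nat.mul_le_mul_left 2 (Nat.pow_le_pow_left (by have := (le_bigS F x).1; omega) _)
    exact (Nat.pow_le_pow_right (by norm_num) (Nat.min_le_left _ _)).trans (h2.trans h3)
  have hN := reg_le_bigS F x
  have hB : bigB T (kay q c F x) ≤ 2 * (bigS F x * (q * c * (bigS F x + 1) + 1 + 1)) + (q * c * (bigS F x + 1) + 1) + 4 := by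
    unfold bigB
    have := Nat.mul_le_mul hT (Nat.add_le_add_right hk 1)
    omega
  exact Nat.mul_le_mul h1 (by omega)

end Sizes

/-! ### The shortness hypotheses of the core -/

section Short

variable {Y : List Bool} {k : ℕ} (gs : List (QGate cliffordT N)) (l₀ : List (QReg N × ZW))

/-- **No overflow.** If the initial table has `2^k` items with amplitudes bounded by `1` and the
yardstick dominates `2^k (4N + 28B + 46)`, `B = 2T(k+1) + k + 4`, then all tables, partial sums and
partial statistics of the run are short. [folklore] -/
theorem short_of_yard (hl : l₀.length = 2 ^ k) (hb : ∀ p ∈ l₀, Bdd 1 p.2)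
    (hY : 2 ^ k * (4 * N + 28 * bigB gs.length k + 46) ≤ Y.length) :
    TblShort Y gs l₀ ∧ SumsShort Y gs l₀ ∧ StatsShort Y (tblRun gs l₀) := by
  set L := 2 ^ k with hL
  set T := gs.length with hT
  set B := bigB T k with hBdef
  have hL1 : 1 ≤ L := Nat.one_le_two_pow
  have h2L : 1 ≤ 2 * L := by omega
  -- the universal coefficient bound
  have hM : (2 * L) ^ T < 2 ^ B := by
    have := two_mul_pow_le (le_refl (2 ^ k)) T
    rw [← hL] at this
    refine lt_of_le_of_lt this (Nat.pow_lt_pow_right (by norm_num) ?_)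
    simp only [hBdef, bigB]; omega
  have hYB : 28 * B + 46 ≤ Y.length :=
    le_trans (le_trans (by omega : 28 * B + 46 ≤ 4 * N + 28 * B + 46) (Nat.le_mul_of_pos_left _ hL1)) hY
  -- amplitudes along the run
  have hrun : ∀ gs₁ gs₂, gs = gs₁ ++ gs₂ → ∀ p ∈ tblRun gs₁ l₀, Bdd ((2 * L) ^ gs₁.length) p.2 := by
    intro gs₁ gs₂ hsplit p hp
    have := bdd_tblRun gs₁ l₀ hb p hp
    rwa [hl, mul_one] at this
  have hpow : ∀ t ≤ T, (2 * L) ^ t ≤ (2 * L) ^ T := fun t ht => Nat.pow_le_pow_right h2L ht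
  refine ⟨?_, ?_, ?_⟩
  · intro gs₁ gs₂ hsplit
    have ht : gs₁.length ≤ T := by rw [hT, hsplit]; simp
    have hbd : ∀ p ∈ tblRun gs₁ l₀, Bdd ((2 * L) ^ T) p.2 := fun p hp => (hrun gs₁ gs₂ hsplit p hp).mono (hpow _ ht)
    have := length_tableEnc_le (tblRun gs₁ l₀) hbd hM
    rw [length_tblRun, hl] at this
    exact this.trans (hY.trans (Nat.le_succ _))
  · intro gs₁ g gs₂ hsplit z _ l₁ l₂ hl₁
    have ht : gs₁.length + 1 ≤ T := by rw [hT, hsplit]; simp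
    have hbd : ∀ p ∈ l₁, Bdd ((2 * L) ^ gs₁.length) p.2 := fun p hp =>
      hrun gs₁ (g :: gs₂) hsplit p (by rw [hl₁]; exact List.mem_append_left _ hp)
    have hps := bdd_partialSum g z l₁ hbd
    have hlen₁ : l₁.length ≤ L := by
      have := congrArg List.length hl₁
      rw [length_tblRun, hl, List.length_append] at this; omega
    have hps' : Bdd ((2 * L) ^ T) (partialSum g z 0 l₁) := by
      refine hps.mono (le_trans ?_ (hpow _ ht))
      rw [pow_succ]
      nlinarith [hlen₁, Nat.zero_le ((2 * L) ^ gs₁.length)]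
    exact (length_enc_le_of_bdd hps' hM).trans (by omega)
  · intro l₁ l₂ hl₁
    have hbd : ∀ p ∈ l₁, Bdd ((2 * L) ^ T) p.2 := fun p hp =>
      hrun gs [] (by simp) p (by rw [hl₁]; exact List.mem_append_left _ hp)
    have hlen₁ : l₁.length ≤ L := by
      have := congrArg List.length hl₁
      rw [length_tblRun, hl, List.length_append] at this; omega
    have hU := natAbs_statU_le l₁ hbd
    have hV := natAbs_statV_le l₁ hbd
    -- `L · 4 M² < 2^{B-1}`
    have hsq : L * (4 * ((2 * L) ^ T * (2 * L) ^ T)) < 2 ^ (B - 1) := by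
      have h1 : (2 * L) ^ T * (2 * L) ^ T ≤ 2 ^ (T * (k + 1)) * 2 ^ (T * (k + 1)) := by
        have := two_mul_pow_le (le_refl (2 ^ k)) T
        rw [← hL] at this
        exact Nat.mul_le_mul this this
      calc L * (4 * ((2 * L) ^ T * (2 * L) ^ T)) ≤ 2 ^ k * (2 ^ 2 * (2 ^ (T * (k + 1)) * 2 ^ (T * (k + 1)))) := by
            rw [hL]; exact Nat.mul_le_mul_left _ (Nat.mul_le_mul_left _ h1)
        _ = 2 ^ (k + 2 + T * (k + 1) + T * (k + 1)) := by rw [pow_add, pow_add, pow_add]; ring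
        _ < 2 ^ (B - 1) := Nat.pow_lt_pow_right (by norm_num) (by simp only [hBdef, bigB]; omega)
    have hU' : (statU l₁).natAbs < 2 ^ (B - 1) := lt_of_le_of_lt (hU.trans (Nat.mul_le_mul_right _ hlen₁)) hsq
    have hV' : (statV l₁).natAbs < 2 ^ (B - 1) := lt_of_le_of_lt (hV.trans (Nat.mul_le_mul_right _ hlen₁)) hsq
    have h1 := length_dpEnc_le_of_lt hU'
    have h2 := length_dpEnc_le_of_lt hV'
    rw [length_boolPair]
    omega

end Short

/-! ### The decider is correct -/

section Correct

variable (q c : ℕ) (F : QCircuitFamily cliffordT)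

/-- The window of the machine on register size `M`: the wires below `K₀`. [folklore] -/
def window (K M : ℕ) : Finset (Fin M) := Finset.univ.filter fun i => (i : ℕ) < K

/-- Membership in the window. [folklore] -/
@[simp] theorem mem_window {K M : ℕ} (i : Fin M) : i ∈ window K M ↔ (i : ℕ) < K := by simp [window]

/-- `wires ⊆ window ↔ InWindow`. [folklore] -/
theorem wires_subset_window_iff {K M : ℕ} (g : QGate cliffordT M) : g.wires ⊆ window K M ↔ InWindow K g := by
  simp [InWindow, Finset.subset_iff]

/-- A circuit on no wire has no gate. [folklore] -/
theorem gates_eq_nil_of_reg_zero {M : ℕ} (hM : M = 0) (C : QCircuit cliffordT M) : C.gates = [] := by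
  subst hM; exact gates_eq_nil_of_zero C

variable {F}

/-- **The bridge to `probAcc`** for the windowed circuit (nonempty register). [folklore] -/
theorem acceptProb_filter_eq_probAcc (hF : F.IsOracleFree) (x : List Bool) (K : ℕ)
    (hM : 0 < x.length + F.ancillas x.length) :
    (⟨((F.circ x.length).gates).filter fun g => decide (InWindow K g)⟩ :
        QCircuit cliffordT (x.length + F.ancillas x.length)).acceptProb 0 x.get =
      probAcc omega (((F.circ x.length).gates).filter fun g => decide (InWindow K g)) (w₀ F x) hM := by
  have hC : (⟨((F.circ x.length).gates).filter fun g => decide (InWindow K g)⟩ :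
      QCircuit cliffordT (x.length + F.ancillas x.length)).IsOracleFree :=
    fun g hg => hF x.length g (List.mem_of_mem_filter hg)
  unfold QCircuit.acceptProb probAcc QCircuit.runOn
  rw [← prodZeta_omega 0 hC]
  refine Finset.sum_congr rfl fun z _ => ?_
  rw [dif_pos hM]
  rfl

/-- **The decider computes `[p(x) > 1/2]`.** For an oracle-free family whose wire-`0` light cones
lie inside the windows `[0, K₀)`, on every input `x` the decider with the yardstick `yardPoly q c`
outputs the bit `[1/2 < P[wire 0 of F.circ |x| on |x 0^m⟩ reads 1]]`.
[cite: MarkovShi2008, §1 (Cor. 1.5; deterministic simulation: the exact probability)] -/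
theorem deciderF_correct (hF : F.IsOracleFree)
    (hcone : ∀ (n : ℕ) (h : 0 < n + F.ancillas n),
      (LightCone.cone (F.circ n).gates {⟨0, h⟩}).1 ⊆ window (kay0 q c n) (n + F.ancillas n))
    (x : List Bool) :
    deciderF q c (yardPoly q c) F x = [decide (1 / 2 < F.acceptProbOn 0 x)] := by
  set N := x.length + F.ancillas x.length with hN
  set k := kay q c F x with hk
  have hkN : k ≤ N := kay_le q c F x
  set labs := winLabs k hkN (w₀ F x) with hlabs
  set gs := ((F.circ x.length).gates).filter (fun g => decide (InWindow (kay0 q c x.length) g)) with hgs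
  have hof : ∀ g ∈ gs, g.IsOracleFree := fun g hg => hF x.length g (List.mem_of_mem_filter hg)
  have hwin : ∀ g ∈ gs, InWindow (kay0 q c x.length) g := fun g hg => of_decide_eq_true (List.mem_filter.1 hg).2
  -- the core on the genuine argument
  have hY1 := two_pow_kay_le_yard q c F x
  have hT : gs.length ≤ bigS F x := (List.length_filter_le _ _).trans (gates_le_bigS F x)
  have hl₀ : (tbl0 q c F x).length = 2 ^ k := by simp [tbl0, hk]
  have hb₀ : ∀ p ∈ tbl0 q c F x, Bdd 1 p.2 := fun p hp => by
    simp only [tbl0, List.mem_map] at hp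
    obtain ⟨z, -, rfl⟩ := hp
    exact bdd_dpInit _ _
  obtain ⟨hTS, hSS, hStS⟩ := short_of_yard gs (tbl0 q c F x) hl₀ hb₀ (table_le_yard q c F x gs.length hT)
  rw [deciderF_eq_coreF q c (yardPoly q c) x hF hY1, simCoreF_genuine _ gs hof _ hTS hSS hStS]
  -- the table of the run is `dpRun` over the labels
  have hrun : tblRun gs (tbl0 q c F x) = (List.reverse^[gs.length] labs).map fun z => (z, dpRun gs labs (dpInit (w₀ F x)) z) :=
    tblRun_map gs labs _
  set labsT := List.reverse^[gs.length] labs with hlabsT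
  have hperm : labsT.Perm labs := iterate_reverse_perm _ _
  have hU : statU (tblRun gs (tbl0 q c F x)) = accU labsT (dpRun gs labsT (dpInit (w₀ F x))) := by
    rw [hrun, statU_map, ← dpRun_perm hperm]
  have hV : statV (tblRun gs (tbl0 q c F x)) = accV labsT (dpRun gs labsT (dpInit (w₀ F x))) := by
    rw [hrun, statV_map, ← dpRun_perm hperm]
  rw [hU, hV]
  congr 1
  -- the enumeration and the closure of the window set
  have hnd : labsT.Nodup := hperm.nodup_iff.2 (nodup_winLabs k hkN (w₀ F x))
  have hmem : ∀ w, w ∈ labsT ↔ w ∈ winSet k (w₀ F x) := fun w => by rw [hperm.mem_iff, hlabs, mem_winLabs_iff]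
  have hcl : ∀ g ∈ gs, ∀ cb w, w ∈ winSet k (w₀ F x) → ∀ w' ψ, pathStep g cb w = some (w', ψ) → w' ∈ winSet k (w₀ F x) :=
    fun g hg cb w hw w' ψ hps => winSet_closed k (w₀ F x) g (fun i hi => by
      have h1 := hwin g hg i hi
      have h2 : (i : ℕ) < N := i.2
      simp only [hk, kay]; omega) cb w hw w' ψ hps
  by_cases hM : 0 < N
  · -- nonempty register: the exact sign test of `half_lt_probAcc_iff`
    have key := half_lt_probAcc_iff hnd hmem gs hof hcl (base_mem_winSet k (w₀ F x)) hM
    have hp : F.acceptProbOn 0 x = probAcc omega gs (w₀ F x) hM := by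
      have h1 := LightCone.acceptProb_eq_acceptProb_filter_subset cliffordT_isUnitary_holds 0 (F.circ x.length) x.get
        (window (kay0 q c x.length) N) (fun h => hcone x.length h)
      have h2 : ((F.circ x.length).gates.filter fun g => decide (g.wires ⊆ window (kay0 q c x.length) N)) = gs :=
        List.filter_congr fun g _ => decide_eq_decide.mpr (wires_subset_window_iff g)
      have h3 := acceptProb_filter_eq_probAcc hF x (kay0 q c x.length) hM
      rw [QCircuitFamily.acceptProbOn, h1, h2]
      exact h3
    rw [hp]
    by_cases h : 1 / 2 < probAcc omega gs (w₀ F x) hM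
    · rw [decide_eq_true h, key.1 h]
    · rw [decide_eq_false h]
      cases hb : posSqrtTwoTest (2 * accU labsT (dpRun gs labsT (dpInit (w₀ F x))) - 2 ^ hCount gs)
          (2 * accV labsT (dpRun gs labsT (dpInit (w₀ F x))))
      · rfl
      · exact absurd (key.2 hb) h
  · -- empty register: no gate, no accepting label, probability `0`
    have hN0 : N = 0 := by omega
    have hgs0 : gs = [] := by
      rw [hgs, gates_eq_nil_of_reg_zero hN0]; rfl
    have hU0 : accU labsT (dpRun gs labsT (dpInit (w₀ F x))) = 0 := by
      unfold accU
      rw [List.sum_eq_zero]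
      intro v hv
      obtain ⟨z, -, rfl⟩ := List.mem_map.1 hv
      rw [if_neg (fun ⟨h, _⟩ => hM h)]
    have hV0 : accV labsT (dpRun gs labsT (dpInit (w₀ F x))) = 0 := by
      unfold accV
      rw [List.sum_eq_zero]
      intro v hv
      obtain ⟨z, -, rfl⟩ := List.mem_map.1 hv
      rw [if_neg (fun ⟨h, _⟩ => hM h)]
    rw [hU0, hV0, hgs0, acceptProbOn_eq_zero 0 x hN0]
    norm_num [posSqrtTwoTest, hCount]

/-- **Small prefix windows are decidable**: for a polynomial-time uniform, oracle-free Clifford+`T`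
family whose wire-`0` light cones lie inside the windows `[0, K₀)`, `K₀ = qc (|bin n| + 1) + 1`, the
threshold language `{x | p(x) > 1/2}` is decidable in polynomial time — by the simulator
(`deciderF_mem_FP`, `deciderF_correct`). [cite: MarkovShi2008, §1 (Cor. 1.2 and Cor. 1.5)] -/
theorem polyTimeDecidable_of_cone_subset_window (hF : F.IsOracleFree) (hU : F.IsUniform)
    (hcone : ∀ (n : ℕ) (h : 0 < n + F.ancillas n),
      (LightCone.cone (F.circ n).gates {⟨0, h⟩}).1 ⊆ window (kay0 q c n) (n + F.ancillas n)) :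
    PolyTimeDecidable id {x : List Bool | 1 / 2 < F.acceptProbOn 0 x} := by
  refine mem_P_iff_holds.1 (mem_P_of_mem_FP (deciderF_mem_FP q c (yardPoly q c) hU) _ fun z => ?_)
  rw [deciderF_correct q c hF hcone z]
  exact ⟨fun h => by rw [decide_eq_true (p := 1 / 2 < F.acceptProbOn 0 z) h],
    fun h => by rw [decide_eq_false (p := 1 / 2 < F.acceptProbOn 0 z) fun h' => h h']⟩

end Correct

end ConeSim

end Literature.Computability.QuantumComplexity

end
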